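/-
Origin: written from primary sources — S. Kudla, *Seesaw dual reductive pairs* (1984) §1 (a see-saw partner need not
sit in block position: the second torus `U(W₃) × U(W₄)` of a hermitian plane `W` is the CONJUGATE by a rational
isometry of a block-diagonal torus); A. Weil, *Sur certains groupes d'opérateurs unitaires*, Acta Math. 111 (1964)
Chap. III n° 40–41, Thm 6 p. 193 (rational symplectic elements lift to `Θ`-fixing metaplectic operators `r_F(σ)`);
C. Mœglin, M.-F. Vignéras, J.-L. Waldspurger, *Correspondances de Howe sur un corps p-adique* (1987) Chap. 2 II.1
(transport of structure of `Mp_ψ` along an isometry). Adapted: no. This file is GLUE: it conjugates a homomorphism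
into the adelic metaplectic group of record by a fixed (`Θ`-fixing) element and relabels the Gram matrix
(`AdelicMetaplecticTransport`), so that the see-saw character of `AdelicMetaplecticSeesawKronecker` becomes available
for a CONJUGATED see-saw torus; the rational lift of `AdelicMetaplecticRationalLift` is the intended conjugator.
Kernel only; no records; the group-side square (position of the conjugated torus) is a hypothesis.
-/
import Literature.NumberTheory.Weil1964.AdelicMetaplecticRationalLift
import Literature.NumberTheory.Weil1964.AdelicMetaplecticTransport
import Literature.NumberTheory.Weil1964.AdelicMetaplecticSeesawKronecker
import HarnessLib

-- buildfix G11b-3 recipe (LEDGER B13-1/B13-3): elaborate sequentially so the trailing `attribute [implicit_reducible]`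
-- block (reducibilityCoreExt is keyed to the async environment branch) is in force at `.olean` export.
set_option Elab.async false

/-!
# The see-saw character of a conjugated torus: conjugation and relabelling in `Mp_ψ(W_𝔸)ᶜᵒⁿᵗ`

Fix a number field `F`, a finite index type `κ`, two Gram matrices `T, T′ ∈ M_κ(𝔸_F)` related by a relabelling
`T C = T′` (`C ∈ GL_κ(𝔸_F)`), and an element `r ∈ Mp_ψ(W_T)ᶜᵒⁿᵗ` (model case: Weil's `Θ`-fixing lift
`r = r_F(h₀)` of a RATIONAL symplectic element `h₀`, `AdelicMetaplecticRationalLift.ratPointsThetaLiftCont`).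

* §1 `conjRelabel r C hC : Mp_ψ(W_T)ᶜᵒⁿᵗ ≃* Mp_ψ(W_{T′})ᶜᵒⁿᵗ`, `p ↦ relabel_{C⁻¹} (r⁻¹ p r)`: its projection is
  `Λ_{C⁻¹} (π(r)⁻¹ π(p) π(r)) Λ_{C⁻¹}⁻¹` (`proj_conjRelabel`), its Weil operator is `ω(r)⁻¹ ω(p) ω(r)` — the relabelling
  does not move operators (`omega_conjRelabel`, `omega_apply_omega_conjRelabel`), and it preserves `Θ`-fixing when
  `r` is `Θ`-fixing (`coe_conjRelabel_mem_adelicMpTheta_iff`).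
* §2 for a homomorphism `S : P →* Mp_ψ(W_T)ᶜᵒⁿᵗ` (model case: a splitting of the dual pair `(U(V), U(W))` composed
  with `(v, u′) ↦ (v, g u′ g⁻¹)`), `conjSplitting S r C hC := conjRelabel ∘ S : P →* Mp_ψ(W_{T′})ᶜᵒⁿᵗ`, and THE SEAM
  LEMMA `proj_conjSplitting_eq`: if `π(r) · (Λ_C ι′(p) Λ_C⁻¹) · π(r)⁻¹ = π(S p)` for all `p` (the group-side square
  of a conjugated see-saw, [Kudla1984, §1]; in the tree: unitary-2's `UnitaryGroupSeesawConjugation`), then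
  `π(conjSplitting S p) = ι′(p)` — the conjugated homomorphism lies over the see-saw embedding `ι′` for the Gram
  matrix `T′`; `omega_conjSplitting_eq_iff` moves any identity of Weil operators back to the original model;
  `ratConjSplitting` is the specialisation `r := r_F(h₀)`.
* §3 Kronecker coordinates `κ = n × (m₁ ⊕ m₂)`, `T′ = T_V ⊗ (T₁ ⊕ T₂)`: the see-saw character
  **`mpSeesawCharConj S r C hC s₁ s₂ hS hT₁ hT₂ : P →* ℂˣ`** `:= mpSeesawCharKron (conjSplitting S r C hC) s₁ s₂ …`
  (so the whole API of `AdelicMetaplecticSeesawKronecker` / `AdelicMetaplecticSeesawCharacter` applies, `_def`), its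
  defining identity IN THE ORIGINAL MODEL
  `ω(S p) (ω(r) (Φ₁ ⊠ₖ Φ₂)) = χ(p) • ω(r) (ω(s₁ p) Φ₁ ⊠ₖ ω(s₂ p) Φ₂)` (`mpSeesawCharConj_spec`; this is the shape
  `M g (R (Φ₁ ⊠ Φ₂)) = χ(g) • R (A₁ g Φ₁ ⊠ A₂ g Φ₂)` of `AdelicSchwartzBruhatTensorCharacterTransported` with
  `R = ω(r) ∘ R_e⁻¹`), `χ(p) = 1` at `Θ`-fixing triples (`mpSeesawCharConj_eq_one_of_mem_adelicMpTheta`), and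
  `hS_of_square` producing the hypothesis `hS` from the group-side square plus the block-diagonal see-saw identity.

Provenance / use (Hodge-CM model-construction cell, node W2-⊗ «(34)-transport», consumer leaf of C-α
`AdelicMetaplecticRationalLift` and C-β `UnitaryGroupSeesawConjugation`): the `(34)`-side see-saw torus of PerL's
hermitian plane is `g (U(W₃) × U(W₄)) g⁻¹` for a rational isometry `g : (W, T_{W′}) → (W, T_W)`; with
`r := ratPointsThetaLiftCont … ⟨h₀, _⟩` over the rational symplectic element `h₀` of C-β and `C` its relabelling, the
big splitting `S` conjugated by `r` is a splitting over the `(34)`-adapted Gram matrix, and the `(34)` restriction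
identity of the oscillator representation is `mpSeesawCharConj_spec`. No continuity statement is made: conjugation
by the non-pointwise operator `ω(r)` does not preserve the coefficient topology of `Mp_ψ(W_𝔸)`.

Implementation note: as in `AdelicMetaplecticSeesawKronecker`, symplectic-group-valued objects are typed through
`adelicForm`, and cross-group equalities are stated as equalities of underlying linear equivalences `(…).1 = (…).1`.
-/

set_option autoImplicit false

noncomputable section

open NumberField
open scoped Matrix Kronecker Classical

namespace Literature.NumberTheory.Weil1964

open Literature.RepresentationTheory.HeisenbergGroup Literature.NumberTheory.Automorphic IsDedekindDomain
open Literature.NumberTheory.Automorphic.UnitaryGroup (symplecticGroupCongr coe_symplecticGroupCongr_apply)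
open Literature.RepresentationTheory.HeisenbergGroup.SymplecticMatrix (transportSp mapHom)

/-! ## §0 Three lines of group algebra (generic; used to keep every step away from `rw` over heavy types) -/

section Algebra

variable {G H M : Type*} [Group G] [Group H] [Monoid M]

/-- `a x a⁻¹ = b ⇒ a⁻¹ b a = x`. [folklore] -/
theorem inv_mul_mul_eq_of_mul_mul_inv_eq {a x b : G} (h : a * x * a⁻¹ = b) : a⁻¹ * b * a = x := by
  rw [← h]; group

/-- `r⁻¹ p r ∈ K ↔ p ∈ K` for `r ∈ K`. [folklore] -/
theorem inv_mul_mul_mem_iff (K : Subgroup G) {r : G} (hr : r ∈ K) (p : G) : r⁻¹ * p * r ∈ K ↔ p ∈ K := by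
  constructor
  · intro h
    have e : p = r * (r⁻¹ * p * r) * r⁻¹ := by group
    rw [e]
    exact mul_mem (mul_mem hr h) (inv_mem hr)
  · intro h
    exact mul_mem (mul_mem (inv_mem hr) h) hr

/-- a group homomorphism on `r⁻¹ p r`. [folklore] -/
theorem map_inv_mul_mul (f : G →* H) (r p : G) : f (r⁻¹ * p * r) = (f r)⁻¹ * f p * f r := by
  simp only [map_mul, map_inv]

/-- a monoid-valued homomorphism on `r⁻¹ p r`. [folklore] -/
theorem map_inv_mul_mul' (f : G →* M) (r p : G) : f (r⁻¹ * p * r) = f r⁻¹ * f p * f r := by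
  simp only [map_mul]

/-- `f r (f r⁻¹ m) = m` for a representation-like homomorphism into endomorphisms. [folklore] -/
theorem map_apply_map_inv_apply {V : Type*} [AddCommGroup V] [Module ℂ V] (f : G →* (V →ₗ[ℂ] V)) (r : G) (v : V) :
    f r (f r⁻¹ v) = v := by
  change (f r * f r⁻¹) v = v
  rw [← map_mul, mul_inv_cancel, map_one]
  rfl

/-- `f r⁻¹ (f r m) = m`. [folklore] -/
theorem map_inv_apply_map_apply {V : Type*} [AddCommGroup V] [Module ℂ V] (f : G →* (V →ₗ[ℂ] V)) (r : G) (v : V) :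
    f r⁻¹ (f r v) = v := by
  change (f r⁻¹ * f r) v = v
  rw [← map_mul, inv_mul_cancel, map_one]
  rfl

end Algebra

/-! ## §1 Conjugation by a fixed element followed by relabelling -/

section ConjRelabel

variable (F : Type) [Field F] [NumberField F] (κ : Type) [Fintype κ] [DecidableEq κ]
  {T T' : Matrix κ κ (AdeleRing (𝓞 F) F)} (r : adelicMpCont F κ T) (C : GL κ (AdeleRing (𝓞 F) F))
  (hC : T * (C : Matrix κ κ (AdeleRing (𝓞 F) F)) = T')

/-- **`p ↦ relabel_{C⁻¹} (r⁻¹ p r)`**: conjugation by `r⁻¹` in `Mp_ψ(W_T)ᶜᵒⁿᵗ` followed by the relabelling of record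
along `T′ C⁻¹ = T`, a homomorphism `Mp_ψ(W_T)ᶜᵒⁿᵗ →* Mp_ψ(W_{T′})ᶜᵒⁿᵗ` (an isomorphism; only the homomorphism is used).
[cite: MoeglinVignerasWaldspurger1987, Chap. 2 II.1 (A)–(B)] -/
def conjRelabel : adelicMpCont F κ T →* adelicMpCont F κ T' :=
  (adelicMpContRelabel F κ C⁻¹ (mul_inv_eq_of_relabel F κ C hC)).toMonoidHom.comp
    (MulAut.conj r).symm.toMonoidHom

/-- Unfolding: `conjRelabel r C hC p = relabel_{C⁻¹} (r⁻¹ * p * r)`. [folklore] -/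
theorem conjRelabel_apply (p : adelicMpCont F κ T) :
    conjRelabel F κ r C hC p = adelicMpContRelabel F κ C⁻¹ (mul_inv_eq_of_relabel F κ C hC) (r⁻¹ * p * r) :=
  rfl

/-- **Projection**: `π(conjRelabel p) = Λ_{C⁻¹} (π(r)⁻¹ π(p) π(r)) Λ_{C⁻¹}⁻¹`.
[cite: MoeglinVignerasWaldspurger1987, Chap. 2 II.1 (A)] -/
theorem proj_conjRelabel (p : adelicMpCont F κ T) :
    adelicMpCont.proj F κ T' (conjRelabel F κ r C hC p) =
      symplecticGroupCongr _ _ (relabelVec F κ C⁻¹) (polar_relabelVec F κ C⁻¹ (mul_inv_eq_of_relabel F κ C hC))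
        ((adelicMpCont.proj F κ T r)⁻¹ * adelicMpCont.proj F κ T p * adelicMpCont.proj F κ T r) :=
  (adelicMpCont.proj_relabel F κ C⁻¹ (mul_inv_eq_of_relabel F κ C hC) (r⁻¹ * p * r)).trans
    (congrArg
      (symplecticGroupCongr _ _ (relabelVec F κ C⁻¹) (polar_relabelVec F κ C⁻¹ (mul_inv_eq_of_relabel F κ C hC)))
      (map_inv_mul_mul (adelicMpCont.proj F κ T) r p))

/-- **Weil operator**: `ω(conjRelabel p) = ω(r⁻¹) ω(p) ω(r)` — the relabelling does not move operators.
[cite: MoeglinVignerasWaldspurger1987, Chap. 2 II.1 (B)] -/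
theorem omega_conjRelabel (p : adelicMpCont F κ T) :
    adelicMpCont.omega F κ T' (conjRelabel F κ r C hC p) =
      adelicMpCont.omega F κ T r⁻¹ * adelicMpCont.omega F κ T p * adelicMpCont.omega F κ T r :=
  (adelicMpCont.omega_relabel F κ C⁻¹ (mul_inv_eq_of_relabel F κ C hC) (r⁻¹ * p * r)).trans
    (map_inv_mul_mul' (adelicMpCont.omega F κ T) r p)

/-- pointwise: `ω(conjRelabel p) Ψ = ω(r⁻¹) (ω(p) (ω(r) Ψ))`. [folklore] -/
theorem omega_conjRelabel_apply (p : adelicMpCont F κ T) (Ψ : piSchwartzBruhat F κ) :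
    adelicMpCont.omega F κ T' (conjRelabel F κ r C hC p) Ψ =
      adelicMpCont.omega F κ T r⁻¹ (adelicMpCont.omega F κ T p (adelicMpCont.omega F κ T r Ψ)) :=
  LinearMap.congr_fun (omega_conjRelabel F κ r C hC p) Ψ

/-- **transport back**: `ω(r) (ω(conjRelabel p) Ψ) = ω(p) (ω(r) Ψ)`. [folklore] -/
theorem omega_apply_omega_conjRelabel (p : adelicMpCont F κ T) (Ψ : piSchwartzBruhat F κ) :
    adelicMpCont.omega F κ T r (adelicMpCont.omega F κ T' (conjRelabel F κ r C hC p) Ψ) =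
      adelicMpCont.omega F κ T p (adelicMpCont.omega F κ T r Ψ) :=
  (congrArg (adelicMpCont.omega F κ T r) (omega_conjRelabel_apply F κ r C hC p Ψ)).trans
    (map_apply_map_inv_apply (adelicMpCont.omega F κ T) r _)

/-- **an identity of Weil operators after `conjRelabel` is the conjugated identity before**:
`ω(conjRelabel p) Ψ = Ψ′ ↔ ω(p) (ω(r) Ψ) = ω(r) Ψ′`. [folklore] -/
theorem omega_conjRelabel_eq_iff (p : adelicMpCont F κ T) (Ψ Ψ' : piSchwartzBruhat F κ) :
    adelicMpCont.omega F κ T' (conjRelabel F κ r C hC p) Ψ = Ψ' ↔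
      adelicMpCont.omega F κ T p (adelicMpCont.omega F κ T r Ψ) = adelicMpCont.omega F κ T r Ψ' := by
  constructor
  · intro h
    exact (omega_apply_omega_conjRelabel F κ r C hC p Ψ).symm.trans (congrArg (adelicMpCont.omega F κ T r) h)
  · intro h
    have h' := congrArg (adelicMpCont.omega F κ T r⁻¹) ((omega_apply_omega_conjRelabel F κ r C hC p Ψ).trans h)
    exact ((map_inv_apply_map_apply (adelicMpCont.omega F κ T) r _).symm.trans h').trans
      (map_inv_apply_map_apply (adelicMpCont.omega F κ T) r Ψ')

/-- **`Θ`-fixing is preserved** when the conjugator `r` is `Θ`-fixing (the relabelling preserves `Θ`-fixing for every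
`C`, the operator being unchanged). [cite: Weil1964, Chap. III n° 41 Thm 6 p. 193] -/
theorem coe_conjRelabel_mem_adelicMpTheta_iff (hr : (r : adelicMp F κ T) ∈ adelicMpTheta F κ T)
    (p : adelicMpCont F κ T) :
    ((conjRelabel F κ r C hC p : adelicMpCont F κ T') : adelicMp F κ T') ∈ adelicMpTheta F κ T' ↔
      (p : adelicMp F κ T) ∈ adelicMpTheta F κ T :=
  (coe_adelicMpContRelabel_mem_adelicMpTheta_iff F κ C⁻¹ (mul_inv_eq_of_relabel F κ C hC) (r⁻¹ * p * r)).trans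
    (inv_mul_mul_mem_iff (adelicMpTheta F κ T) hr (p : adelicMp F κ T))

/-- **cancellation of the two relabellings**: `Congr_{Λ_{C⁻¹}} (Congr_{Λ_C} g) = g`. [folklore] -/
theorem symplecticGroupCongr_relabelVec_inv_relabelVec (g : symplecticGroup (polar (adelicForm F κ T'))) :
    symplecticGroupCongr _ _ (relabelVec F κ C⁻¹) (polar_relabelVec F κ C⁻¹ (mul_inv_eq_of_relabel F κ C hC))
        (symplecticGroupCongr _ _ (relabelVec F κ C) (polar_relabelVec F κ C hC) g) = g := by
  refine Subtype.ext (LinearEquiv.ext fun w => ?_)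
  have h1 : (relabelVec F κ C).symm ((relabelVec F κ C⁻¹).symm w) = w := by
    refine Prod.ext rfl ?_
    simp only [relabelVec_symm_apply, inv_inv, Matrix.mulVec_mulVec, Units.inv_mul, Matrix.one_mulVec]
  have h2 : ∀ y : (κ → AdeleRing (𝓞 F) F) × (κ → AdeleRing (𝓞 F) F),
      relabelVec F κ C⁻¹ (relabelVec F κ C y) = y := fun y => by
    refine Prod.ext rfl ?_
    simp only [relabelVec_apply, Matrix.mulVec_mulVec, Units.inv_mul, Matrix.one_mulVec]
  rw [coe_symplecticGroupCongr_apply, coe_symplecticGroupCongr_apply, h1, h2]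

end ConjRelabel

/-! ## §2 Conjugated homomorphisms and the seam lemma -/

section ConjSplitting

variable (F : Type) [Field F] [NumberField F] (κ : Type) [Fintype κ] [DecidableEq κ]
  {T T' : Matrix κ κ (AdeleRing (𝓞 F) F)} (r : adelicMpCont F κ T) (C : GL κ (AdeleRing (𝓞 F) F))
  (hC : T * (C : Matrix κ κ (AdeleRing (𝓞 F) F)) = T')
  {P : Type*} [Group P] (S : P →* adelicMpCont F κ T)

/-- **The conjugated homomorphism** `conjRelabel ∘ S : P →* Mp_ψ(W_{T′})ᶜᵒⁿᵗ`, `p ↦ relabel_{C⁻¹} (r⁻¹ S(p) r)`.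
(Model case: `S` a splitting of a dual pair composed with the conjugation of its second factor by a rational
isometry, `r = r_F(h₀)`.) (cf. S. Kudla (1984) §1) [folklore] -/
def conjSplitting : P →* adelicMpCont F κ T' :=
  (conjRelabel F κ r C hC).comp S

/-- Unfolding. [folklore] -/
@[simp] theorem conjSplitting_apply (p : P) : conjSplitting F κ r C hC S p = conjRelabel F κ r C hC (S p) := rfl

/-- `π(conjSplitting S p) = Λ_{C⁻¹} (π(r)⁻¹ π(S p) π(r)) Λ_{C⁻¹}⁻¹`. [cite: MoeglinVignerasWaldspurger1987, Chap. 2 II.1 (A)] -/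
theorem proj_conjSplitting (p : P) :
    adelicMpCont.proj F κ T' (conjSplitting F κ r C hC S p) =
      symplecticGroupCongr _ _ (relabelVec F κ C⁻¹) (polar_relabelVec F κ C⁻¹ (mul_inv_eq_of_relabel F κ C hC))
        ((adelicMpCont.proj F κ T r)⁻¹ * adelicMpCont.proj F κ T (S p) * adelicMpCont.proj F κ T r) :=
  proj_conjRelabel F κ r C hC (S p)

/-- `ω(conjSplitting S p) Ψ = ω(r⁻¹) (ω(S p) (ω(r) Ψ))`. [folklore] -/
theorem omega_conjSplitting_apply (p : P) (Ψ : piSchwartzBruhat F κ) :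
    adelicMpCont.omega F κ T' (conjSplitting F κ r C hC S p) Ψ =
      adelicMpCont.omega F κ T r⁻¹ (adelicMpCont.omega F κ T (S p) (adelicMpCont.omega F κ T r Ψ)) :=
  omega_conjRelabel_apply F κ r C hC (S p) Ψ

/-- `ω(r) (ω(conjSplitting S p) Ψ) = ω(S p) (ω(r) Ψ)`. [folklore] -/
theorem omega_apply_omega_conjSplitting (p : P) (Ψ : piSchwartzBruhat F κ) :
    adelicMpCont.omega F κ T r (adelicMpCont.omega F κ T' (conjSplitting F κ r C hC S p) Ψ) =
      adelicMpCont.omega F κ T (S p) (adelicMpCont.omega F κ T r Ψ) :=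
  omega_apply_omega_conjRelabel F κ r C hC (S p) Ψ

/-- `ω(conjSplitting S p) Ψ = Ψ′ ↔ ω(S p) (ω(r) Ψ) = ω(r) Ψ′`. [folklore] -/
theorem omega_conjSplitting_eq_iff (p : P) (Ψ Ψ' : piSchwartzBruhat F κ) :
    adelicMpCont.omega F κ T' (conjSplitting F κ r C hC S p) Ψ = Ψ' ↔
      adelicMpCont.omega F κ T (S p) (adelicMpCont.omega F κ T r Ψ) = adelicMpCont.omega F κ T r Ψ' :=
  omega_conjRelabel_eq_iff F κ r C hC (S p) Ψ Ψ'

/-- `Θ`-fixing values correspond (for a `Θ`-fixing conjugator). [cite: Weil1964, Chap. III n° 41 Thm 6 p. 193] -/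
theorem coe_conjSplitting_mem_adelicMpTheta_iff (hr : (r : adelicMp F κ T) ∈ adelicMpTheta F κ T) (p : P) :
    ((conjSplitting F κ r C hC S p : adelicMpCont F κ T') : adelicMp F κ T') ∈ adelicMpTheta F κ T' ↔
      ((S p : adelicMpCont F κ T) : adelicMp F κ T) ∈ adelicMpTheta F κ T :=
  coe_conjRelabel_mem_adelicMpTheta_iff F κ r C hC hr (S p)

/-- **THE SEAM LEMMA.** If the group-side square `π(r) · Congr_{Λ_C}(ι′ p) · π(r)⁻¹ = π(S p)` holds for all `p`
(the conjugated torus in position: [Kudla1984, §1]; in the tree `UnitaryGroupSeesawConjugation.adelicSeesawConj_conj`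
chained with `π ∘ σ = ι_{V,W}`), then the conjugated homomorphism lies over `ι′`: `π(conjSplitting S p) = ι′ p`.
(cf. S. Kudla (1984) §1) [folklore] -/
theorem proj_conjSplitting_eq (ι' : P → symplecticGroup (polar (adelicForm F κ T')))
    (hsq : ∀ p : P, adelicMpCont.proj F κ T r *
        symplecticGroupCongr _ _ (relabelVec F κ C) (polar_relabelVec F κ C hC) (ι' p) *
        (adelicMpCont.proj F κ T r)⁻¹ = adelicMpCont.proj F κ T (S p)) (p : P) :
    adelicMpCont.proj F κ T' (conjSplitting F κ r C hC S p) = ι' p :=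
  (proj_conjSplitting F κ r C hC S p).trans
    ((congrArg
      (symplecticGroupCongr _ _ (relabelVec F κ C⁻¹) (polar_relabelVec F κ C⁻¹ (mul_inv_eq_of_relabel F κ C hC)))
      (inv_mul_mul_eq_of_mul_mul_inv_eq (hsq p))).trans
      (symplecticGroupCongr_relabelVec_inv_relabelVec F κ C hC (ι' p)))

end ConjSplitting

/-! ### The rational conjugator `r_F(h₀)` -/

section Rational

variable (F : Type) [Field F] [NumberField F] (κ : Type) [Fintype κ] [DecidableEq κ]
  {T T' : Matrix κ κ (AdeleRing (𝓞 F) F)} (hT : IsUnit T.det)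
  (h₀ : symplecticGroup (polar (adelicForm F κ T)))
  (hrat : h₀ ∈ ((transportSp T hT).comp (mapHom (algebraMap F (AdeleRing (𝓞 F) F)))).range)
  (C : GL κ (AdeleRing (𝓞 F) F)) (hC : T * (C : Matrix κ κ (AdeleRing (𝓞 F) F)) = T')
  {P : Type*} [Group P] (S : P →* adelicMpCont F κ T)

/-- **The conjugated homomorphism along Weil's rational lift**: `conjSplitting S (r_F h₀) C hC` with
`r_F h₀ := ratPointsThetaLiftCont F κ T hT ⟨h₀, hrat⟩`. [cite: Weil1964, Chap. III n° 40 p. 190] -/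
def ratConjSplitting : P →* adelicMpCont F κ T' :=
  conjSplitting F κ (ratPointsThetaLiftCont F κ T hT ⟨h₀, hrat⟩) C hC S

/-- Unfolding. [folklore] -/
theorem ratConjSplitting_def :
    ratConjSplitting F κ hT h₀ hrat C hC S =
      conjSplitting F κ (ratPointsThetaLiftCont F κ T hT ⟨h₀, hrat⟩) C hC S :=
  rfl

/-- `π(ratConjSplitting S p) = Λ_{C⁻¹} (h₀⁻¹ π(S p) h₀) Λ_{C⁻¹}⁻¹`. [cite: Weil1964, Chap. III n° 40 p. 190] -/
theorem proj_ratConjSplitting (p : P) :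
    adelicMpCont.proj F κ T' (ratConjSplitting F κ hT h₀ hrat C hC S p) =
      symplecticGroupCongr _ _ (relabelVec F κ C⁻¹) (polar_relabelVec F κ C⁻¹ (mul_inv_eq_of_relabel F κ C hC))
        (h₀⁻¹ * adelicMpCont.proj F κ T (S p) * h₀) :=
  (proj_conjSplitting F κ _ C hC S p).trans
    (congrArg
      (symplecticGroupCongr _ _ (relabelVec F κ C⁻¹) (polar_relabelVec F κ C⁻¹ (mul_inv_eq_of_relabel F κ C hC)))
      (congrArg (fun a => a⁻¹ * adelicMpCont.proj F κ T (S p) * a)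
        (proj_ratPointsThetaLiftCont F κ T hT ⟨h₀, hrat⟩)))

/-- **Seam lemma, rational form**: `h₀ · Congr_{Λ_C}(ι′ p) · h₀⁻¹ = π(S p)` for all `p` implies
`π(ratConjSplitting S p) = ι′ p`. (cf. S. Kudla (1984) §1) [folklore] -/
theorem proj_ratConjSplitting_eq (ι' : P → symplecticGroup (polar (adelicForm F κ T')))
    (hsq : ∀ p : P, h₀ * symplecticGroupCongr _ _ (relabelVec F κ C) (polar_relabelVec F κ C hC) (ι' p) * h₀⁻¹ =
      adelicMpCont.proj F κ T (S p)) (p : P) :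
    adelicMpCont.proj F κ T' (ratConjSplitting F κ hT h₀ hrat C hC S p) = ι' p :=
  proj_conjSplitting_eq F κ _ C hC S ι'
    (fun q => (congrArg
      (fun a => a * symplecticGroupCongr _ _ (relabelVec F κ C) (polar_relabelVec F κ C hC) (ι' q) * a⁻¹)
      (proj_ratPointsThetaLiftCont F κ T hT ⟨h₀, hrat⟩)).trans (hsq q)) p

/-- `Θ`-fixing values correspond (the rational lift is `Θ`-fixing). [cite: Weil1964, Chap. III n° 41 Thm 6 p. 193] -/
theorem coe_ratConjSplitting_mem_adelicMpTheta_iff (p : P) :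
    ((ratConjSplitting F κ hT h₀ hrat C hC S p : adelicMpCont F κ T') : adelicMp F κ T') ∈ adelicMpTheta F κ T' ↔
      ((S p : adelicMpCont F κ T) : adelicMp F κ T) ∈ adelicMpTheta F κ T :=
  coe_conjSplitting_mem_adelicMpTheta_iff F κ _ C hC S (coe_ratPointsThetaLiftCont_mem_adelicMpTheta F κ T hT _) p

/-- `ω(r_F h₀) (ω(ratConjSplitting S p) Ψ) = ω(S p) (ω(r_F h₀) Ψ)`. [folklore] -/
theorem omega_apply_omega_ratConjSplitting (p : P) (Ψ : piSchwartzBruhat F κ) :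
    adelicMpCont.omega F κ T (ratPointsThetaLiftCont F κ T hT ⟨h₀, hrat⟩)
        (adelicMpCont.omega F κ T' (ratConjSplitting F κ hT h₀ hrat C hC S p) Ψ) =
      adelicMpCont.omega F κ T (S p) (adelicMpCont.omega F κ T (ratPointsThetaLiftCont F κ T hT ⟨h₀, hrat⟩) Ψ) :=
  omega_apply_omega_conjSplitting F κ _ C hC S p Ψ

end Rational

/-! ## §3 The see-saw character of the conjugated homomorphism in Kronecker coordinates -/

section Seesaw

variable {F : Type} [Field F] [NumberField F] {n m₁ m₂ : Type} [Fintype n] [DecidableEq n] [Fintype m₁]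
  [DecidableEq m₁] [Fintype m₂] [DecidableEq m₂]
  {TV : Matrix n n (AdeleRing (𝓞 F) F)} {T₁ : Matrix m₁ m₁ (AdeleRing (𝓞 F) F)} {T₂ : Matrix m₂ m₂ (AdeleRing (𝓞 F) F)}
  {T : Matrix (n × (m₁ ⊕ m₂)) (n × (m₁ ⊕ m₂)) (AdeleRing (𝓞 F) F)}
  (r : adelicMpCont F (n × (m₁ ⊕ m₂)) T) (C : GL (n × (m₁ ⊕ m₂)) (AdeleRing (𝓞 F) F))
  (hC : T * (C : Matrix (n × (m₁ ⊕ m₂)) (n × (m₁ ⊕ m₂)) (AdeleRing (𝓞 F) F)) = TV ⊗ₖ Matrix.fromBlocks T₁ 0 0 T₂)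
  {P : Type*} [Group P]
  (S : P →* adelicMpCont F (n × (m₁ ⊕ m₂)) T)
  (s₁ : P →* adelicMpCont F (n × m₁) (TV ⊗ₖ T₁)) (s₂ : P →* adelicMpCont F (n × m₂) (TV ⊗ₖ T₂))

/-- **`hS` from the two group-side identities**: the square `π(r) · Congr_{Λ_C}(ι′ p) · π(r)⁻¹ = π(S p)` (conjugated
torus) and the block-diagonal see-saw identity `W_e ι′(p) W_e⁻¹ = π(s₁ p) ⊕ π(s₂ p)` (unitary-2's
`pairToSymplectic_dualPair_blockDiag` shape) give the hypothesis `hS` of `mpSeesawCharKron` for `conjSplitting S r C hC`.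
(cf. S. Kudla (1984) §1) [folklore] -/
theorem hS_of_square (ι' : P → symplecticGroup (polar (adelicForm F (n × (m₁ ⊕ m₂)) (TV ⊗ₖ Matrix.fromBlocks T₁ 0 0 T₂))))
    (hsq : ∀ p : P, adelicMpCont.proj F (n × (m₁ ⊕ m₂)) T r *
        symplecticGroupCongr _ _ (relabelVec F (n × (m₁ ⊕ m₂)) C) (polar_relabelVec F (n × (m₁ ⊕ m₂)) C hC) (ι' p) *
        (adelicMpCont.proj F (n × (m₁ ⊕ m₂)) T r)⁻¹ = adelicMpCont.proj F (n × (m₁ ⊕ m₂)) T (S p))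
    (hbd : ∀ p : P,
      (UnitaryGroup.spReindex (Equiv.prodSumDistrib n m₁ m₂) (TV ⊗ₖ Matrix.fromBlocks T₁ 0 0 T₂) (ι' p)).1 =
        (UnitaryGroup.spSum (TV ⊗ₖ T₁) (TV ⊗ₖ T₂)
          (adelicMpCont.proj F (n × m₁) (TV ⊗ₖ T₁) (s₁ p), adelicMpCont.proj F (n × m₂) (TV ⊗ₖ T₂) (s₂ p))).1) :
    ∀ p : P,
      (UnitaryGroup.spReindex (Equiv.prodSumDistrib n m₁ m₂) (TV ⊗ₖ Matrix.fromBlocks T₁ 0 0 T₂)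
          (adelicMpCont.proj F (n × (m₁ ⊕ m₂)) (TV ⊗ₖ Matrix.fromBlocks T₁ 0 0 T₂)
            (conjSplitting F (n × (m₁ ⊕ m₂)) r C hC S p))).1 =
        (UnitaryGroup.spSum (TV ⊗ₖ T₁) (TV ⊗ₖ T₂)
          (adelicMpCont.proj F (n × m₁) (TV ⊗ₖ T₁) (s₁ p), adelicMpCont.proj F (n × m₂) (TV ⊗ₖ T₂) (s₂ p))).1 :=
  fun p =>
  (congrArg
    (fun g => (UnitaryGroup.spReindex (Equiv.prodSumDistrib n m₁ m₂) (TV ⊗ₖ Matrix.fromBlocks T₁ 0 0 T₂) g).1)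
    (proj_conjSplitting_eq F (n × (m₁ ⊕ m₂)) r C hC S ι' hsq p)).trans (hbd p)

variable
  (hS : ∀ p : P,
    (UnitaryGroup.spReindex (Equiv.prodSumDistrib n m₁ m₂) (TV ⊗ₖ Matrix.fromBlocks T₁ 0 0 T₂)
        (adelicMpCont.proj F (n × (m₁ ⊕ m₂)) (TV ⊗ₖ Matrix.fromBlocks T₁ 0 0 T₂)
          (conjSplitting F (n × (m₁ ⊕ m₂)) r C hC S p))).1 =
      (UnitaryGroup.spSum (TV ⊗ₖ T₁) (TV ⊗ₖ T₂)
        (adelicMpCont.proj F (n × m₁) (TV ⊗ₖ T₁) (s₁ p), adelicMpCont.proj F (n × m₂) (TV ⊗ₖ T₂) (s₂ p))).1)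
  (hT₁ : IsUnit (TV ⊗ₖ T₁)) (hT₂ : IsUnit (TV ⊗ₖ T₂))

/-- **THE SEE-SAW CHARACTER OF A CONJUGATED TORUS** `χ : P →* ℂˣ` — `mpSeesawCharKron` of the conjugated homomorphism
`conjSplitting S r C hC` against `s₁, s₂`. (cf. R. Howe (1979) §3; S. Kudla (1984) §1) [folklore] -/
def mpSeesawCharConj : P →* ℂˣ :=
  mpSeesawCharKron (conjSplitting F (n × (m₁ ⊕ m₂)) r C hC S) s₁ s₂ hS hT₁ hT₂

/-- By definition `mpSeesawCharConj … = mpSeesawCharKron (conjSplitting S r C hC) s₁ s₂ …` — so every statement of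
`AdelicMetaplecticSeesawKronecker` and (by `mpSeesawCharKron_def`) of `AdelicMetaplecticSeesawCharacter` applies to
it. [folklore] -/
theorem mpSeesawCharConj_def :
    mpSeesawCharConj r C hC S s₁ s₂ hS hT₁ hT₂ =
      mpSeesawCharKron (conjSplitting F (n × (m₁ ⊕ m₂)) r C hC S) s₁ s₂ hS hT₁ hT₂ :=
  rfl

/-- **The defining identity in the transported model** (Gram matrix `T_V ⊗ (T₁ ⊕ T₂)`):
`ω(conjSplitting S p) (kronTensor Φ₁ Φ₂) = χ(p) • kronTensor (ω(s₁ p) Φ₁) (ω(s₂ p) Φ₂)`. [folklore] -/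
theorem mpSeesawCharConj_spec_transported (p : P) (Φ₁ : piSchwartzBruhat F (n × m₁))
    (Φ₂ : piSchwartzBruhat F (n × m₂)) :
    adelicMpCont.omega F (n × (m₁ ⊕ m₂)) (TV ⊗ₖ Matrix.fromBlocks T₁ 0 0 T₂)
        (conjSplitting F (n × (m₁ ⊕ m₂)) r C hC S p) (kronTensor F Φ₁ Φ₂) =
      (mpSeesawCharConj r C hC S s₁ s₂ hS hT₁ hT₂ p : ℂ) •
        kronTensor F (adelicMpCont.omega F (n × m₁) (TV ⊗ₖ T₁) (s₁ p) Φ₁)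
          (adelicMpCont.omega F (n × m₂) (TV ⊗ₖ T₂) (s₂ p) Φ₂) :=
  mpSeesawCharKron_spec (conjSplitting F (n × (m₁ ⊕ m₂)) r C hC S) s₁ s₂ hS hT₁ hT₂ p Φ₁ Φ₂

/-- **THE DEFINING IDENTITY IN THE ORIGINAL MODEL** (Gram matrix `T`; the restriction of the big oscillator
representation to a CONJUGATED see-saw torus is the tensor of the small ones along the transported tensor
`R := ω(r) ∘ R_e⁻¹ ∘ ⊠`, up to the character):
`ω(S p) (ω(r) (kronTensor Φ₁ Φ₂)) = χ(p) • ω(r) (kronTensor (ω(s₁ p) Φ₁) (ω(s₂ p) Φ₂))`.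
(cf. S. Kudla, Seesaw dual reductive pairs (1984) §1; R. Howe (1979) §3) [folklore] -/
theorem mpSeesawCharConj_spec (p : P) (Φ₁ : piSchwartzBruhat F (n × m₁)) (Φ₂ : piSchwartzBruhat F (n × m₂)) :
    adelicMpCont.omega F (n × (m₁ ⊕ m₂)) T (S p)
        (adelicMpCont.omega F (n × (m₁ ⊕ m₂)) T r (kronTensor F Φ₁ Φ₂)) =
      (mpSeesawCharConj r C hC S s₁ s₂ hS hT₁ hT₂ p : ℂ) •
        adelicMpCont.omega F (n × (m₁ ⊕ m₂)) T r
          (kronTensor F (adelicMpCont.omega F (n × m₁) (TV ⊗ₖ T₁) (s₁ p) Φ₁)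
            (adelicMpCont.omega F (n × m₂) (TV ⊗ₖ T₂) (s₂ p) Φ₂)) :=
  ((omega_apply_omega_conjSplitting F (n × (m₁ ⊕ m₂)) r C hC S p (kronTensor F Φ₁ Φ₂)).symm.trans
    (congrArg (adelicMpCont.omega F (n × (m₁ ⊕ m₂)) T r)
      (mpSeesawCharConj_spec_transported r C hC S s₁ s₂ hS hT₁ hT₂ p Φ₁ Φ₂))).trans
    (LinearMap.map_smul _ _ _)

/-- **`χ(p) = 1` when `S p`, `s₁ p`, `s₂ p` are `Θ`-fixing and the conjugator `r` is** (rational points; `r = r_F(h₀)`).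
[cite: Weil1964, Chap. III n° 41 Thm 6 p. 193] -/
theorem mpSeesawCharConj_eq_one_of_mem_adelicMpTheta
    (hr : (r : adelicMp F (n × (m₁ ⊕ m₂)) T) ∈ adelicMpTheta F (n × (m₁ ⊕ m₂)) T) {p : P}
    (hp : ((S p : adelicMpCont F (n × (m₁ ⊕ m₂)) T) : adelicMp F (n × (m₁ ⊕ m₂)) T) ∈
      adelicMpTheta F (n × (m₁ ⊕ m₂)) T)
    (hp₁ : (s₁ p : adelicMp F (n × m₁) (TV ⊗ₖ T₁)) ∈ adelicMpTheta F (n × m₁) (TV ⊗ₖ T₁))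
    (hp₂ : (s₂ p : adelicMp F (n × m₂) (TV ⊗ₖ T₂)) ∈ adelicMpTheta F (n × m₂) (TV ⊗ₖ T₂)) :
    mpSeesawCharConj r C hC S s₁ s₂ hS hT₁ hT₂ p = 1 :=
  mpSeesawCharKron_eq_one_of_mem_adelicMpTheta (conjSplitting F (n × (m₁ ⊕ m₂)) r C hC S) s₁ s₂ hS hT₁ hT₂
    ((coe_conjSplitting_mem_adelicMpTheta_iff F (n × (m₁ ⊕ m₂)) r C hC S hr p).2 hp) hp₁ hp₂

end Seesaw

/-! ### Build-lane note (ops-buildfix G11b-3 recipe, LEDGER B13-1, 2026-08-21)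
`lean -o` (the hub build lane, never `lean`/the gate check) runs Lean 4.32's library-suggestion indexers
(`Lean.LibrarySuggestions.SymbolFrequency` / `SineQuaNon`, from their `exportEntriesFn`) over the statement of
every local theorem that is not a denied premise; on this family's statements (very large dependent binder
telescopes through the theta-kernel / dual-pair data) that fold runs for tens of minutes to hours and the build
lane kills the job (incident G11b-3, run/shared/lean/ops/buildfix/G11b-3-DOSSIER.md). `isDeniedPremise` skips
`[implicit_reducible]` constants before any fold, and a reducibility status on a *theorem* is inert (Meta never
unfolds `thmInfo`; the kernel ignores the attribute), so the public theorems of this file are tagged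
`[implicit_reducible]` purely to keep them out of that index. Only other effect: they are not offered by
`+suggestions` premise selectors. No statement or proof is changed; superseded if the operator lands a
deny-list form (`HarnessLib.PremiseIndex`). -/
set_option allowUnsafeReducibility true in
attribute [implicit_reducible]
  inv_mul_mul_eq_of_mul_mul_inv_eq inv_mul_mul_mem_iff map_inv_mul_mul map_inv_mul_mul'
  map_apply_map_inv_apply map_inv_apply_map_apply conjRelabel_apply proj_conjRelabel
  omega_conjRelabel omega_conjRelabel_apply omega_apply_omega_conjRelabel omega_conjRelabel_eq_iff
  coe_conjRelabel_mem_adelicMpTheta_iff symplecticGroupCongr_relabelVec_inv_relabelVec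
  conjSplitting_apply proj_conjSplitting omega_conjSplitting_apply omega_apply_omega_conjSplitting
  omega_conjSplitting_eq_iff coe_conjSplitting_mem_adelicMpTheta_iff proj_conjSplitting_eq
  ratConjSplitting_def proj_ratConjSplitting proj_ratConjSplitting_eq
  coe_ratConjSplitting_mem_adelicMpTheta_iff omega_apply_omega_ratConjSplitting hS_of_square
  mpSeesawCharConj_def mpSeesawCharConj_spec_transported mpSeesawCharConj_spec
  mpSeesawCharConj_eq_one_of_mem_adelicMpTheta

end Literature.NumberTheory.Weil1964

end
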